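import Mathlib
import Summits.Parity.GeneralizedHardyLittlewood.Theorems.LiouvilleMADFanDecorrelationStubFanFromLaws
import Summits.Parity.GeneralizedHardyLittlewood.Theorems.LiouvilleMADFanDecorrelationStubNarrowOfPointwise
import Summits.Parity.GeneralizedHardyLittlewood.Theorems.LiouvilleMADFanDecorrelationStubTransfer
import Summits.Parity.GeneralizedHardyLittlewood.Theorems.LiouvilleMADFanDecorrelationStubWindowPartition

/-!
# The fan decorrelation crux from the two height laws (line `SketchIdeator5`, stub `stub_fanOfHeightLaws`)

Stub `stub_fanOfHeightLaws` of the crux `FanDecorrelation`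
(`Summit.Parity.GeneralizedHardyLittlewood.Theses.LiouvilleMAD`, stmt-Parity-13318), line `SketchIdeator5`
(idea `mellin-height-law`): the line's whole provable content in ONE importable theorem — the
POINTWISE LAW (power saving `|D(h)| ≤ C M^{1−κ}` at every single lag `2|h| ≥ Q`) and the WIDE
HEIGHT LAW (`|Σ_j φ((j−P)/D) D(kj)| ≤ C_φ M^{3/4+ϑ_φ}` for smooth windows of width `D ≥ M^δ`, every
`δ > 0`) imply the body of the route declaration `FanDecorrelation`.

Notation (informal; nothing is defined here): `Q = ⌊√M⌋+1`, `λ = ArithmeticFunction.liouville`,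
`D(h) = Σ_{(m,m') ∈ (M,2M]², m−m'=h} λ(mn+c)λ(m'n'+c)`, `R_k = Σ_{j∈[Q,2Q)} D(kj)`.

Proof = composition of the landed stubs of the line: narrow windows from the pointwise law
(`NarrowOfPointwise.stub_narrowOfPointwise`, p110115), glue narrow ⊕ wide into the full height law
(`heightLaw_of_narrow_wide`, here), the dyadic window partition (`WindowPartition.stub_windowPartition`,
p110178) and the transfer (`Transfer.stub_transfer`, p110154).  Both hypotheses are conjecture-grade
(13319-class resp. second-order/ratios-class); this theorem is the kernel-checked NORMAL FORM
`pointwise law ∧ wide height law ⟹ FanDecorrelation`, non-circular (no hypothesis instance is a crux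
instance).
-/

open scoped BigOperators

namespace Summit.Parity.GeneralizedHardyLittlewood.Theorems.FanDecorrelation.FanOfHeightLaws

/-- Narrow (`D ≤ M^{δ}`, some `δ > 0`) and wide (`D ≥ M^{δ}`, every `δ > 0`) height laws combine
to the full height law (`ϑ = max ϑ₁ ϑ₂`, `C = max (max C₁ C₂) 0`). [folklore] -/
theorem heightLaw_of_narrow_wide
    (hN : ∀ φ : ℝ → ℝ, ContDiff ℝ (⊤ : ℕ∞) φ → (∀ x : ℝ, φ x ≠ 0 → |x| ≤ 2) →
      ∀ c : ℤ, c ≠ 0 → ∃ δ : ℝ, 0 < δ ∧ ∃ ϑ : ℝ, ϑ < 1 / 4 ∧ ∃ C : ℝ,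
        ∀ M n n' : ℕ, ∀ k : ℤ, ∀ P D : ℝ,
          1 ≤ n → 1 ≤ n' → n ≠ n' → n ≤ 2 * M → n' ≤ 2 * M → k ≠ 0 →
            1 ≤ D → D ≤ (M : ℝ) ^ δ → 8 * D ≤ (Nat.sqrt M : ℝ) + 1 →
              (Nat.sqrt M : ℝ) + 1 ≤ P → P ≤ 2 * ((Nat.sqrt M : ℝ) + 1) →
                |∑ j ∈ Finset.Icc 1 (2 * M), φ (((j : ℝ) - P) / D) *
                    ∑ p ∈ (Finset.Ioc M (2 * M) ×ˢ Finset.Ioc M (2 * M)).filter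
                        (fun p : ℕ × ℕ => (p.1 : ℤ) - p.2 = k * (j : ℤ)),
                      (ArithmeticFunction.liouville (Int.toNat ((p.1 : ℤ) * n + c)) : ℝ) *
                        (ArithmeticFunction.liouville (Int.toNat ((p.2 : ℤ) * n' + c)) : ℝ)| ≤
                  C * (M : ℝ) ^ (3 / 4 + ϑ))
    (hW : ∀ φ : ℝ → ℝ, ContDiff ℝ (⊤ : ℕ∞) φ → (∀ x : ℝ, φ x ≠ 0 → |x| ≤ 2) →
      ∀ c : ℤ, c ≠ 0 → ∀ δ : ℝ, 0 < δ → ∃ ϑ : ℝ, ϑ < 1 / 4 ∧ ∃ C : ℝ,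
        ∀ M n n' : ℕ, ∀ k : ℤ, ∀ P D : ℝ,
          1 ≤ n → 1 ≤ n' → n ≠ n' → n ≤ 2 * M → n' ≤ 2 * M → k ≠ 0 →
            (M : ℝ) ^ δ ≤ D → 8 * D ≤ (Nat.sqrt M : ℝ) + 1 →
              (Nat.sqrt M : ℝ) + 1 ≤ P → P ≤ 2 * ((Nat.sqrt M : ℝ) + 1) →
                |∑ j ∈ Finset.Icc 1 (2 * M), φ (((j : ℝ) - P) / D) *
                    ∑ p ∈ (Finset.Ioc M (2 * M) ×ˢ Finset.Ioc M (2 * M)).filter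
                        (fun p : ℕ × ℕ => (p.1 : ℤ) - p.2 = k * (j : ℤ)),
                      (ArithmeticFunction.liouville (Int.toNat ((p.1 : ℤ) * n + c)) : ℝ) *
                        (ArithmeticFunction.liouville (Int.toNat ((p.2 : ℤ) * n' + c)) : ℝ)| ≤
                  C * (M : ℝ) ^ (3 / 4 + ϑ)) :
    ∀ φ : ℝ → ℝ, ContDiff ℝ (⊤ : ℕ∞) φ → (∀ x : ℝ, φ x ≠ 0 → |x| ≤ 2) →
      ∀ c : ℤ, c ≠ 0 → ∃ ϑ : ℝ, ϑ < 1 / 4 ∧ ∃ C : ℝ, ∀ M n n' : ℕ, ∀ k : ℤ, ∀ P D : ℝ,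
        1 ≤ n → 1 ≤ n' → n ≠ n' → n ≤ 2 * M → n' ≤ 2 * M → k ≠ 0 →
          1 ≤ D → 8 * D ≤ (Nat.sqrt M : ℝ) + 1 →
            (Nat.sqrt M : ℝ) + 1 ≤ P → P ≤ 2 * ((Nat.sqrt M : ℝ) + 1) →
              |∑ j ∈ Finset.Icc 1 (2 * M), φ (((j : ℝ) - P) / D) *
                  ∑ p ∈ (Finset.Ioc M (2 * M) ×ˢ Finset.Ioc M (2 * M)).filter
                      (fun p : ℕ × ℕ => (p.1 : ℤ) - p.2 = k * (j : ℤ)),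
                    (ArithmeticFunction.liouville (Int.toNat ((p.1 : ℤ) * n + c)) : ℝ) *
                      (ArithmeticFunction.liouville (Int.toNat ((p.2 : ℤ) * n' + c)) : ℝ)| ≤
                C * (M : ℝ) ^ (3 / 4 + ϑ) := by
  intro φ hφ hsupp c hc
  obtain ⟨δ, hδ, ϑ₁, hϑ₁, C₁, h₁⟩ := hN φ hφ hsupp c hc
  obtain ⟨ϑ₂, hϑ₂, C₂, h₂⟩ := hW φ hφ hsupp c hc δ hδ
  refine ⟨max ϑ₁ ϑ₂, max_lt hϑ₁ hϑ₂, max (max C₁ C₂) 0, ?_⟩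
  intro M n n' k P D hn hn' hnn' hnM hn'M hk hD1 hD8 hP1 hP2
  -- the scale is positive: `1 ≤ n ≤ 2M`
  have hM1 : (1 : ℝ) ≤ M := by
    have : 1 ≤ M := by omega
    exact_mod_cast this
  have hpow : ∀ e : ℝ, e ≤ 3 / 4 + max ϑ₁ ϑ₂ → (M : ℝ) ^ e ≤ (M : ℝ) ^ (3 / 4 + max ϑ₁ ϑ₂) :=
    fun e he => Real.rpow_le_rpow_of_exponent_le hM1 he
  have h0 : 0 ≤ (M : ℝ) ^ (3 / 4 + max ϑ₁ ϑ₂) := Real.rpow_nonneg (by positivity) _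
  rcases le_total D ((M : ℝ) ^ δ) with hle | hge
  · have := h₁ M n n' k P D hn hn' hnn' hnM hn'M hk hD1 hle hD8 hP1 hP2
    calc _ ≤ C₁ * (M : ℝ) ^ (3 / 4 + ϑ₁) := this
      _ ≤ max (max C₁ C₂) 0 * (M : ℝ) ^ (3 / 4 + max ϑ₁ ϑ₂) := by
          have hC : C₁ ≤ max (max C₁ C₂) 0 := le_trans (le_max_left _ _) (le_max_left _ _)
          exact FanFromLaws.const_rpow_le
            hM1 hC (le_max_right _ _) (by linarith [le_max_left ϑ₁ ϑ₂])
  · have := h₂ M n n' k P D hn hn' hnn' hnM hn'M hk hge hD8 hP1 hP2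
    calc _ ≤ C₂ * (M : ℝ) ^ (3 / 4 + ϑ₂) := this
      _ ≤ max (max C₁ C₂) 0 * (M : ℝ) ^ (3 / 4 + max ϑ₁ ϑ₂) := by
          have hC : C₂ ≤ max (max C₁ C₂) 0 := le_trans (le_max_right _ _) (le_max_left _ _)
          exact FanFromLaws.const_rpow_le
            hM1 hC (le_max_right _ _) (by linarith [le_max_right ϑ₁ ϑ₂])

/-- **Normal form (stub `stub_fanOfHeightLaws`, line `SketchIdeator5` of the crux `FanDecorrelation`).**
The pointwise law (hypothesis 1 = stub `stub_pointwiseLaw` verbatim: `|D(h)| ≤ C·M^{1−κ}` for all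
`1 ≤ n ≠ n' ≤ 2M` and every lag with `2|h| ≥ Q`) and the wide height law (hypothesis 2 = stub
`stub_wideLaw` verbatim) imply, for every `c ≠ 0`, `ϑ < 1/4` and `C` with `|R_k| ≤ C·M^{3/4+ϑ}` for
all `M`, `1 ≤ n ≠ n' ≤ 2M`, `k ≠ 0` — the body of
`Summit.Parity.GeneralizedHardyLittlewood.Theses.LiouvilleMAD.FanDecorrelation`. [folklore] -/
theorem stub_fanOfHeightLaws :
    (∀ c : ℤ, c ≠ 0 → ∃ κ : ℝ, 0 < κ ∧ ∃ C : ℝ, ∀ M n n' : ℕ, ∀ h : ℤ,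
      1 ≤ n → 1 ≤ n' → n ≠ n' → n ≤ 2 * M → n' ≤ 2 * M →
        (Nat.sqrt M : ℤ) + 1 ≤ 2 * |h| →
          |∑ p ∈ (Finset.Ioc M (2 * M) ×ˢ Finset.Ioc M (2 * M)).filter
                (fun p : ℕ × ℕ => (p.1 : ℤ) - p.2 = h),
              (ArithmeticFunction.liouville (Int.toNat ((p.1 : ℤ) * n + c)) : ℝ) *
                (ArithmeticFunction.liouville (Int.toNat ((p.2 : ℤ) * n' + c)) : ℝ)| ≤
            C * (M : ℝ) ^ (1 - κ)) →
    (∀ φ : ℝ → ℝ, ContDiff ℝ (⊤ : ℕ∞) φ → (∀ x : ℝ, φ x ≠ 0 → |x| ≤ 2) →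
      ∀ c : ℤ, c ≠ 0 → ∀ δ : ℝ, 0 < δ → ∃ ϑ : ℝ, ϑ < 1 / 4 ∧ ∃ C : ℝ,
        ∀ M n n' : ℕ, ∀ k : ℤ, ∀ P D : ℝ,
          1 ≤ n → 1 ≤ n' → n ≠ n' → n ≤ 2 * M → n' ≤ 2 * M → k ≠ 0 →
            (M : ℝ) ^ δ ≤ D → 8 * D ≤ (Nat.sqrt M : ℝ) + 1 →
              (Nat.sqrt M : ℝ) + 1 ≤ P → P ≤ 2 * ((Nat.sqrt M : ℝ) + 1) →
                |∑ j ∈ Finset.Icc 1 (2 * M), φ (((j : ℝ) - P) / D) *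
                    ∑ p ∈ (Finset.Ioc M (2 * M) ×ˢ Finset.Ioc M (2 * M)).filter
                        (fun p : ℕ × ℕ => (p.1 : ℤ) - p.2 = k * (j : ℤ)),
                      (ArithmeticFunction.liouville (Int.toNat ((p.1 : ℤ) * n + c)) : ℝ) *
                        (ArithmeticFunction.liouville (Int.toNat ((p.2 : ℤ) * n' + c)) : ℝ)| ≤
                  C * (M : ℝ) ^ (3 / 4 + ϑ)) →
    ∀ c : ℤ, c ≠ 0 → ∃ ϑ : ℝ, ϑ < 1 / 4 ∧ ∃ C : ℝ, ∀ M n n' : ℕ, ∀ k : ℤ,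
      1 ≤ n → 1 ≤ n' → n ≠ n' → n ≤ 2 * M → n' ≤ 2 * M → k ≠ 0 →
        |∑ j ∈ Finset.Ico (Nat.sqrt M + 1) (2 * (Nat.sqrt M + 1)),
            ∑ p ∈ (Finset.Ioc M (2 * M) ×ˢ Finset.Ioc M (2 * M)).filter
                (fun p : ℕ × ℕ => (p.1 : ℤ) - p.2 = k * (j : ℤ)),
              (ArithmeticFunction.liouville (Int.toNat ((p.1 : ℤ) * n + c)) : ℝ) *
                (ArithmeticFunction.liouville (Int.toNat ((p.2 : ℤ) * n' + c)) : ℝ)| ≤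
          C * (M : ℝ) ^ (3 / 4 + ϑ) :=
  fun hP hW => Transfer.stub_transfer WindowPartition.stub_windowPartition
    (heightLaw_of_narrow_wide (NarrowOfPointwise.stub_narrowOfPointwise hP) hW)

end Summit.Parity.GeneralizedHardyLittlewood.Theorems.FanDecorrelation.FanOfHeightLaws
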